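import Summits.Ventures.PercRepro.ProfilePointedCircuitClassesTwelveCaptureB
import Summits.Ventures.PercRepro.ProfilePointedCircuitClassesLocalLym

/-!
# PercRepro — THE COCIRCUIT REGIME OF THE TWELVE-POINT STATEMENT, PART A: THE CONFIGURATION AND ITS CLOSURE FACTS
(p5, gen 48; `proofs/P5-GM1.md` §71)

On `#E = 12`, `ρ(E) = 7`, let `{a, a'}` be a series pair and `{a', e, p}` a cocircuit (`ρ(E − {a', e, p}) = 6`, no
two of the three a cocircuit), with `e` off the line of the pair (`ρ{a, a', e} = 3`).  Then `{a, e, p}` is a cocircuit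
as well (series symmetry), and the two hyperplanes `H := E − {a', e, p}` and `G := E − {a, a'}` control every closure
the capture inequality (C) needs: a point of `{a', e, p}` is never in the closure of a subset of `H`, a point of
`{a, a'}` never in the closure of a subset of `G`.  This part collects those facts and two general counting lemmas
(points of a closure do not raise the rank; «coloops» add their number to the rank); part B proves (C) in this
regime and the twelve-point statement at `e`.
-/

open scoped Matroid

namespace PercRepro.Cogirth

open Finset ThmH Skew Shadow Profile

variable {α : Type} [DecidableEq α] {N : Matroid α} [N.Finite]

section TwelveCocircuitA

/-- Adding points of the closure of `X` does not raise the rank. -/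
theorem rk_union_eq_of_subset_clF {X T : Finset α} (hX : X ⊆ gr N) (hT : T ⊆ clF N X) :
    rk N (X ∪ T) = rk N X := by
  have h1 : X ∪ T ⊆ clF N X := union_subset (subset_clF_self_of_subset_gr hX) hT
  have h2 := rk_mono' (M := N) h1
  have h3 := rk_mono' (M := N) (subset_union_left (s₁ := X) (s₂ := T))
  rw [rk_clF_eq_rk] at h2
  omega

/-- A point outside the closure raises the rank by one. -/
theorem rk_insert_eq_add_one_of_notMem_clF {z : α} (hz : z ∈ gr N) {X : Finset α} (hX : X ⊆ gr N)
    (h : z ∉ clF N X) : rk N (insert z X) = rk N X + 1 := by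
  have h1 := rk_insert_le_add_one hz hX
  have h2 := rk_mono' (M := N) (subset_insert z X)
  have h3 : ¬ rk N (insert z X) = rk N X := fun heq => h ((mem_clF_iff_rk_insert_eq hz hX).2 heq)
  omega

/-- **COLOOPS ADD THEIR NUMBER**: if no point of `T` lies in the closure of `X` together with the other points of `T`,
then `ρ(X ∪ T) = ρ(X) + #T`. -/
theorem rk_union_eq_add_card_of_forall_notMem_clF {X T : Finset α} (hX : X ⊆ gr N) (hT : T ⊆ gr N)
    (h : ∀ z ∈ T, z ∉ clF N (X ∪ T.erase z)) : rk N (X ∪ T) = rk N X + T.card := by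
  induction T using Finset.induction_on with
  | empty => simp
  | @insert z T hzT ih =>
    have hT' : T ⊆ gr N := (subset_insert z T).trans hT
    have hz : z ∈ gr N := hT (mem_insert_self z T)
    have h' : ∀ w ∈ T, w ∉ clF N (X ∪ T.erase w) := by
      intro w hw hcl
      apply h w (mem_insert_of_mem hw)
      have hsub : X ∪ T.erase w ⊆ X ∪ (insert z T).erase w :=
        union_subset_union (subset_refl _) (erase_subset_erase w (subset_insert z T))
      exact clF_mono (M := N) hsub hcl
    have hzX : z ∉ clF N (X ∪ T) := by
      have := h z (mem_insert_self z T)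
      rwa [erase_insert hzT] at this
    have hrk : rk N (insert z (X ∪ T)) = rk N (X ∪ T) + 1 :=
      rk_insert_eq_add_one_of_notMem_clF hz (union_subset hX hT') hzX
    rw [union_insert, hrk, ih hT' h', card_insert_of_notMem hzT]
    omega

omit [DecidableEq α] in
/-- An independent set inside the closure of `Y` has at most `ρ(Y)` points. -/
theorem card_le_rk_of_subset_clF_of_indep {Y T : Finset α} (hT : T ⊆ clF N Y) (hTi : rk N T = T.card) :
    T.card ≤ rk N Y := by
  have h1 := rk_mono' (M := N) hT
  rw [rk_clF_eq_rk, hTi] at h1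
  exact h1

/-! ### The configuration: a series pair `{a, a'}` and a cocircuit `{a', e, p}` -/

/-- `E − {a', e, p}` with `a'` put back is `E − {e, p}`. -/
theorem insert_erase_three_eq_erase_two {a' e p : α} (ha' : a' ∈ gr N) (hea' : e ≠ a') (hpa' : p ≠ a') :
    insert a' ((((gr N).erase a').erase e).erase p) = ((gr N).erase e).erase p := by
  rw [← erase_insert_of_ne hpa'.symm, ← erase_insert_of_ne hea'.symm, insert_erase ha']

/-- **THE HYPERPLANE `H = E − {a', e, p}`**: none of `a', e, p` lies in the closure of a subset of `H`
(`ρ(X + x) = ρ(X) + 1`), when `ρ(H) = 6` and each of `E − {e, p}`, `E − {a', p}`, `E − {a', e}` has rank `7`. -/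
theorem rk_insert_eq_add_one_of_subset_cocircuit {a' e p : α} (ha' : a' ∈ gr N) (he : e ∈ gr N) (hp : p ∈ gr N)
    (hea' : e ≠ a') (hpa' : p ≠ a') (hep : e ≠ p)
    (hcoc : rk N ((((gr N).erase a').erase e).erase p) = 6)
    (hc1 : rk N (((gr N).erase a').erase e) = 7) (hc2 : rk N (((gr N).erase a').erase p) = 7)
    (hc3 : rk N (((gr N).erase e).erase p) = 7) {X : Finset α}
    (hX : X ⊆ (((gr N).erase a').erase e).erase p) :
    rk N (insert a' X) = rk N X + 1 ∧ rk N (insert e X) = rk N X + 1 ∧ rk N (insert p X) = rk N X + 1 := by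
  have hHg : (((gr N).erase a').erase e).erase p ⊆ gr N :=
    (erase_subset _ _).trans ((erase_subset _ _).trans (erase_subset _ _))
  refine ⟨?_, ?_, ?_⟩
  · apply rk_insert_eq_add_one_of_subset ha' hX hHg
    rw [insert_erase_three_eq_erase_two ha' hea' hpa', hc3, hcoc]
    omega
  · apply rk_insert_eq_add_one_of_subset he hX hHg
    have heq : insert e ((((gr N).erase a').erase e).erase p) = ((gr N).erase a').erase p := by
      rw [erase_right_comm, insert_erase (mem_erase.2 ⟨hep, mem_erase.2 ⟨hea', he⟩⟩)]
    rw [heq, hc2, hcoc]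
    omega
  · apply rk_insert_eq_add_one_of_subset hp hX hHg
    rw [insert_erase (mem_erase.2 ⟨hep.symm, mem_erase.2 ⟨hpa', hp⟩⟩), hc1, hcoc]
    omega

/-- **THE COCIRCUIT `{a, e, p}` BY SERIES SYMMETRY**: with `G₀ := E − {a, a', e, p}`, both `E − {a', e, p} = G₀ + a`
and `E − {a, e, p} = G₀ + a'` have rank `ρ(G₀) + 1`; so `ρ(G₀) = 5` and `ρ(G₀ + a') = 6` when `ρ(G₀ + a) = 6`. -/
theorem rk_G₀_eq_five_of_cocircuit {a a' e p : α} (h : SeriesPair N a a') (hea : e ≠ a) (hpa : p ≠ a)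
    (hcoc : rk N ((((gr N).erase a').erase e).erase p) = 6) :
    rk N (((((gr N).erase a').erase e).erase p).erase a) = 5 ∧
      rk N (insert a' (((((gr N).erase a').erase e).erase p).erase a)) = 6 := by
  have ha : a ∈ gr N := h.1
  have hne : a ≠ a' := h.2.2.1
  have hG₀ : ((((gr N).erase a').erase e).erase p).erase a ⊆ ((gr N).erase a).erase a' := by
    intro x hx
    simp only [mem_erase] at hx ⊢
    exact ⟨hx.2.2.2.1, hx.1, hx.2.2.2.2⟩
  have haH : a ∈ (((gr N).erase a').erase e).erase p :=
    mem_erase.2 ⟨hpa.symm, mem_erase.2 ⟨hea.symm, mem_erase.2 ⟨hne, ha⟩⟩⟩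
  have h1 := rk_insert_left_eq_add_one_of_seriesPair h hG₀
  have h2 := rk_insert_right_eq_add_one_of_seriesPair h hG₀
  rw [insert_erase haH, hcoc] at h1
  refine ⟨by omega, by omega⟩

/-- Every point of `{a, a', e}` is independent of the others: `ρ{a, a', e} = 3` gives `3 ≤ ρ(Q)` for
`Q = {a, a', e, p}`. -/
theorem three_le_rk_Q {a a' e p : α} (hQ : rk N {a, a', e} = 3) :
    3 ≤ rk N (insert a (insert a' (insert e {p}))) := by
  have hsub : ({a, a', e} : Finset α) ⊆ insert a (insert a' (insert e {p})) := by
    intro x hx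
    simp only [mem_insert, mem_singleton] at hx ⊢
    tauto
  have := rk_mono' (M := N) hsub
  omega

/-- **A CAPTURED DEMAND THROUGH `a` AVOIDS `a'` AND `p`**: for `W ∈ BI_5` with `e, a ∈ W`, the basis `E ∖ W` meets
the cocircuits `{a, a'}` and `{a, e, p}`. -/
theorem not_mem_of_mem_biIndepSets_five_cocircuit (hn : (gr N).card = 12) (hR : rk N (gr N) = 7) {a a' e p : α}
    (h : SeriesPair N a a') (hea : e ≠ a) (hpa : p ≠ a) (hcoc : rk N ((((gr N).erase a').erase e).erase p) = 6) {W : Finset α}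
    (hW : W ∈ biIndepSets N 5) (heW : e ∈ W) (haW : a ∈ W) : a' ∉ W ∧ p ∉ W := by
  have hn5 : (gr N).card = rk N (gr N) + 5 := by omega
  refine ⟨not_mem_of_mem_biIndepSets_of_seriesPair h hn5 hW haW, ?_⟩
  intro hpW
  obtain ⟨hWg, hWc, hWr, hWcompl⟩ := mem_biIndepSets.1 hW
  have hG₀ := (rk_G₀_eq_five_of_cocircuit h hea hpa hcoc).2
  have hsub : gr N \ W ⊆ insert a' (((((gr N).erase a').erase e).erase p).erase a) := by
    intro x hx
    rw [mem_sdiff] at hx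
    by_cases hxa' : x = a'
    · exact hxa' ▸ mem_insert_self _ _
    · apply mem_insert_of_mem
      simp only [mem_erase]
      exact ⟨fun hxa => hx.2 (hxa ▸ haW), fun hxp => hx.2 (hxp ▸ hpW), fun hxe => hx.2 (hxe ▸ heW), hxa', hx.1⟩
  have h1 := rk_mono' (M := N) hsub
  have h2 : (gr N \ W).card = 7 := by rw [card_sdiff_of_subset hWg, hn, hWc]
  rw [hWcompl, h2, hG₀] at h1
  omega

end TwelveCocircuitA

end PercRepro.Cogirth
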